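import Literature.MathematicalPhysics.QuantumFieldTheory.Balaban1983to89.Beta.FibreInverseDecay

/-!
# G-an2-4 ∕ (CONV-C), S-slot node (S3-3), part 1∕2: COORDINATE RESTRICTION and the JOINT MOMENTUM SPACE —
# strip regularity (`B4ContourShift.StripRegular`) lifts along injective re-indexings; one-momentum factors are jointly regular

Self-row «S3-3-ENGINE*» of the G-an2-4 formalisation swarm (unit `b2b-balaban-gan24-formalise-leaf-14`, gen 15): node (S3-3)
«two-momentum Paley–Wiener ⇒ BiLoc» of the row owner's route «S3-fibre²» for the located remainder «E3Shape» of the stencil slot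
(cell journal l.4009; census `HOME/b2b-balaban-gan24-p1/S-SLOT.md` §3 «a two-momentum version of the Paley–Wiener step for BiLoc
(`ExpKernelCalculus.BiLoc` in both arguments; `B4ContourShift.latticeKernel_decay` twice)»).  This is part 1 (symbol side); part 2
is `GAN24/StripRegularBiLoc` (kernel side).  HONEST FRAMING (cell rule, verbatim): «discharging `BetaPertH` makes Bałaban's UV
stability UNCONDITIONAL — a real constructive-QFT result; it is NOT the continuum limit and NOT the Clay problem.»  HONEST DEPENDENCY
(verbatim): «continuum YM on T⁴ ⇐ BetaPertH ∧ nine spine estimates (0/9 proved); BetaPertH ⇐ (D1) ∧ (D4) ∧ CAP+tail; G-an2-4 gates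
asym, D1 and NE2/3/4.»  NOT IN PRINT; OUR BOOKKEEPING: [folklore] several-complex-variables plumbing on top of pv17's generic engine
`B4ContourShift` (GK 1980 Prop. A.2 ∕ B4 p. 586, ONE momentum) and its bound-free variant `FibreInverseDecay.StripHolo`; it mentions
NO object of an2's typed U = 1 system, cites nothing, mints no `Prop`, and DISCHARGES NOTHING of the wall's binders (hS, hSall) or of
«E3Shape».  NOT BetaPertH, NOT continuum, NOT Clay.

## What is proved ([folklore], `0 sorry`)

* §1 COORDINATE RESTRICTION.  For an INJECTIVE re-indexing `σ : Fin (d+1) → Fin (D+1)` and `restrict σ P := P ∘ σ`: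
  `StripHolo A κ → StripHolo (A ∘ restrict σ) κ` and `StripRegular A κ M → StripRegular (A ∘ restrict σ) κ M`
  (`stripHolo_comp_restrict`, `stripRegular_comp_restrict`).  The only point: `StripRegular` asks holomorphy of coordinate slices
  through REAL base points; a slice of `A ∘ restrict σ` in an in-range coordinate `σ j` is the `j`-slice of `A` through the real
  base point `baseOf σ j Q` (`restrict_insertNth_of_eq`), in an out-of-range coordinate it is constant
  (`restrict_insertNth_of_forall_ne`).  Also `stripRegular_finset_sum` (the tree had `.add` only).
* §2 THE JOINT MOMENTUM SPACE of two momenta `p, q ∈ ℂ^{d+1}`, written `Fin (d + 1 + d + 1) → ℂ` (definitionally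
  `Fin ((d+1)+(d+1))`, in the successor shape `Fin (D+1)`, `D = d+1+d`, against which the one-momentum interface elaborates
  unaided): indices `inl2 ∕ inr2`, joint vectors `pair x y` (`= Fin.append`), `pair_inl ∕ pair_inr ∕ inl2_or_inr2 ∕ sum_pair_index ∕
  pair_sub ∕ ofRealVec_pair`, projections `fstC ∕ sndC`, the joint symbol `joint G P := G (fstC P) (sndC P)` (`joint_pair`); the
  LIFTS `stripHolo_compFst ∕ _compSnd`, `stripRegular_compFst ∕ _compSnd` and the product shapes `stripRegular_joint_triple`,
  `stripHolo_joint_triple`: a symbol `A(p)·T(p,q)·B(q)` with one-momentum strip-regular outer factors (e.g. fibre inverses controlled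
  on the strip) and a jointly strip-regular vertex `T` is jointly strip regular with the product bound — with the tree's
  `StripRegular.mul ∕ add`, `StripHolo.mul ∕ add ∕ finset_sum ∕ finset_prod ∕ inv`, `stripHolo_cphase` this covers every finite
  alias-sum symbol `Σ_i A_i(p)·T_i(p,q)·B_i(q)`.
WHAT IS NOT HERE: the kernel side (part 2), any symbol of an2's objects, any `j`-uniform bound.
-/

noncomputable section

open Complex Set MeasureTheory
open Literature.MathematicalPhysics.QuantumFieldTheory.Balaban1983to89
open Literature.MathematicalPhysics.QuantumFieldTheory.Balaban1983to89.Beta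
open B4Strip (ofRealVec Strip)
open B4ContourShift (BZ StripRegular openRect closedRect stripRegular_const)
open FibreInverseDecay (StripHolo stripHolo_of_stripRegular)

namespace Summit.QuantumFields.BalabanUV.Beta.GAN24.StripRegularRestrict

/-! ## §1 Coordinate restriction: strip regularity lifts along an injective re-indexing -/

section Restrict

variable {d D : ℕ}

/-- [folklore] Restriction of a momentum vector `P ∈ ℂ^{D+1}` along a re-indexing `σ`: `(restrict σ P) i = P (σ i)`. -/
def restrict (σ : Fin (d + 1) → Fin (D + 1)) (P : Fin (D + 1) → ℂ) : Fin (d + 1) → ℂ := fun i => P (σ i)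

/-- [folklore] Unfolding lemma. -/
@[simp] theorem restrict_apply (σ : Fin (d + 1) → Fin (D + 1)) (P : Fin (D + 1) → ℂ) (i : Fin (d + 1)) :
    restrict σ P i = P (σ i) := rfl

/-- [folklore] Restriction maps the big strip into the small strip (same half-width). -/
theorem restrict_mem_Strip (σ : Fin (d + 1) → Fin (D + 1)) {κ : ℝ} {P : Fin (D + 1) → ℂ}
    (hP : P ∈ Strip (D + 1) κ) : restrict σ P ∈ Strip (d + 1) κ := fun i => hP (σ i)

/-- [folklore] Restriction is continuous. -/
theorem continuous_restrict (σ : Fin (d + 1) → Fin (D + 1)) : Continuous (restrict σ) :=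
  continuous_pi fun i => continuous_apply (σ i)

/-- [folklore] Off the inserted coordinate, `insertNth` reads the base vector: for `l ≠ i` there is `m` with `i.succAbove m = l`
and `(i.insertNth z w) l = w m` — in particular the value does not depend on `z`. -/
theorem insertNth_apply_of_ne (i l : Fin (D + 1)) (h : l ≠ i) (z : ℂ) (w : Fin D → ℂ) :
    ∃ m : Fin D, i.succAbove m = l ∧ (i.insertNth z w : Fin (D + 1) → ℂ) l = w m := by
  obtain ⟨m, hm⟩ := Fin.exists_succAbove_eq h
  exact ⟨m, hm, by rw [← hm, Fin.insertNth_apply_succAbove]⟩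

/-- [folklore] The value of `insertNth` off the inserted coordinate is independent of the inserted value. -/
theorem insertNth_apply_eq_of_ne (i l : Fin (D + 1)) (h : l ≠ i) (z z' : ℂ) (w : Fin D → ℂ) :
    (i.insertNth z w : Fin (D + 1) → ℂ) l = (i.insertNth z' w : Fin (D + 1) → ℂ) l := by
  obtain ⟨m, hm, h1⟩ := insertNth_apply_of_ne i l h z w
  obtain ⟨m', hm', h2⟩ := insertNth_apply_of_ne i l h z' w
  have hmm : m' = m := Fin.succAbove_right_injective (hm'.trans hm.symm)
  rw [h1, h2, hmm]

/-- [folklore] THE REAL BASE POINT seen by the restricted symbol: for the in-range coordinate `σ j`, the remaining coordinates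
`σ (j.succAbove k)` of a slice point `(σ j).insertNth z (ofRealVec Q)` are real, with values `baseOf σ j Q k`. -/
def baseOf (σ : Fin (d + 1) → Fin (D + 1)) (j : Fin (d + 1)) (Q : Fin D → ℝ) : Fin d → ℝ :=
  fun k => (((σ j).insertNth (0 : ℂ) (ofRealVec Q) : Fin (D + 1) → ℂ) (σ (j.succAbove k))).re

/-- [folklore] Each coordinate of the base point is one of the coordinates of `Q`. -/
theorem baseOf_apply {σ : Fin (d + 1) → Fin (D + 1)} (hσ : Function.Injective σ) (j : Fin (d + 1)) (Q : Fin D → ℝ)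
    (k : Fin d) : ∃ m : Fin D, (σ j).succAbove m = σ (j.succAbove k) ∧ baseOf σ j Q k = Q m := by
  have hne : σ (j.succAbove k) ≠ σ j := fun h => Fin.succAbove_ne j k (hσ h)
  obtain ⟨m, hm, h1⟩ := insertNth_apply_of_ne (σ j) (σ (j.succAbove k)) hne 0 (ofRealVec Q)
  refine ⟨m, hm, ?_⟩
  simp only [baseOf]
  rw [h1]
  simp [ofRealVec]

/-- [folklore] The base point of a Brillouin-zone point lies in the Brillouin zone. -/
theorem baseOf_mem_BZ {σ : Fin (d + 1) → Fin (D + 1)} (hσ : Function.Injective σ) (j : Fin (d + 1)) {Q : Fin D → ℝ}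
    (hQ : Q ∈ BZ D) : baseOf σ j Q ∈ BZ d := by
  refine ⟨fun k => ?_, fun k => ?_⟩
  · obtain ⟨m, -, hm⟩ := baseOf_apply hσ j Q k
    rw [hm]; exact hQ.1 m
  · obtain ⟨m, -, hm⟩ := baseOf_apply hσ j Q k
    rw [hm]; exact hQ.2 m

/-- [folklore] IN-RANGE SLICES: the restriction of the slice point `(σ j).insertNth z (ofRealVec Q)` is the `j`-slice point
`j.insertNth z (ofRealVec (baseOf σ j Q))` of the small space. -/
theorem restrict_insertNth_of_eq {σ : Fin (d + 1) → Fin (D + 1)} (hσ : Function.Injective σ) (j : Fin (d + 1)) (z : ℂ)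
    (Q : Fin D → ℝ) :
    restrict σ ((σ j).insertNth z (ofRealVec Q)) = j.insertNth z (ofRealVec (baseOf σ j Q)) := by
  funext l
  refine Fin.succAboveCases j ?_ ?_ l
  · simp only [restrict_apply, Fin.insertNth_apply_same]
  · intro k
    rw [Fin.insertNth_apply_succAbove, restrict_apply]
    have hne : σ (j.succAbove k) ≠ σ j := fun h => Fin.succAbove_ne j k (hσ h)
    obtain ⟨m, hm, h1⟩ := insertNth_apply_of_ne (σ j) (σ (j.succAbove k)) hne z (ofRealVec Q)
    obtain ⟨m', hm', h2⟩ := baseOf_apply hσ j Q k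
    have hmm : m' = m := Fin.succAbove_right_injective (hm'.trans hm.symm)
    rw [h1]
    simp only [ofRealVec]
    rw [h2, hmm]

/-- [folklore] OUT-OF-RANGE SLICES: if the coordinate `i` is not in the range of `σ`, the restriction of the slice point does
not depend on the inserted value. -/
theorem restrict_insertNth_of_forall_ne {σ : Fin (d + 1) → Fin (D + 1)} (i : Fin (D + 1)) (hi : ∀ j, σ j ≠ i) (z z' : ℂ)
    (w : Fin D → ℂ) : restrict σ (i.insertNth z w) = restrict σ (i.insertNth z' w) := by
  funext l
  simp only [restrict_apply]
  exact insertNth_apply_eq_of_ne i (σ l) (hi l) z z' w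

/-- [folklore] **STRIP HOLOMORPHY LIFTS ALONG AN INJECTIVE RE-INDEXING**: if `A` is strip holomorphic on `ℂ^{d+1}`, then
`P ↦ A (P ∘ σ)` is strip holomorphic on `ℂ^{D+1}` (same half-width). -/
theorem stripHolo_comp_restrict {A : (Fin (d + 1) → ℂ) → ℂ} {κ : ℝ} (h : StripHolo A κ)
    {σ : Fin (d + 1) → Fin (D + 1)} (hσ : Function.Injective σ) :
    StripHolo (fun P : Fin (D + 1) → ℂ => A (restrict σ P)) κ := by
  refine ⟨h.cont.comp (continuous_restrict σ).continuousOn fun P hP => restrict_mem_Strip σ hP, ?_, ?_⟩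
  · intro i Q hQ
    by_cases hi : ∃ j, σ j = i
    · obtain ⟨j, rfl⟩ := hi
      have hfun : (fun z => A (restrict σ ((σ j).insertNth z (ofRealVec Q)))) =
          fun z => A (j.insertNth z (ofRealVec (baseOf σ j Q))) := by
        funext z; rw [restrict_insertNth_of_eq hσ]
      rw [hfun]
      exact h.diff j _ (baseOf_mem_BZ hσ j hQ)
    · push Not at hi
      have hfun : (fun z => A (restrict σ (i.insertNth z (ofRealVec Q)))) =
          fun _ : ℂ => A (restrict σ (i.insertNth 0 (ofRealVec Q))) := by
        funext z; rw [restrict_insertNth_of_forall_ne i hi z 0]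
      rw [hfun]
      exact differentiableOn_const _
  · intro i Q hQ y hy
    by_cases hi : ∃ j, σ j = i
    · obtain ⟨j, rfl⟩ := hi
      show A _ = A _
      rw [restrict_insertNth_of_eq hσ, restrict_insertNth_of_eq hσ]
      exact h.sides j _ (baseOf_mem_BZ hσ j hQ) y hy
    · push Not at hi
      show A _ = A _
      rw [restrict_insertNth_of_forall_ne i hi _ (↑Real.pi + ↑y * I)]

/-- [folklore] **STRIP REGULARITY LIFTS ALONG AN INJECTIVE RE-INDEXING**, with the same bound. -/
theorem stripRegular_comp_restrict {A : (Fin (d + 1) → ℂ) → ℂ} {κ M : ℝ} (h : StripRegular A κ M)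
    {σ : Fin (d + 1) → Fin (D + 1)} (hσ : Function.Injective σ) :
    StripRegular (fun P : Fin (D + 1) → ℂ => A (restrict σ P)) κ M :=
  have hh := stripHolo_comp_restrict (stripHolo_of_stripRegular h) hσ
  ⟨hh.cont, hh.diff, hh.sides, fun _ hP => h.bound _ (restrict_mem_Strip σ hP)⟩

/-- [folklore] FINITE SUMS of strip-regular symbols are strip regular, with the sum of the bounds (the tree has `.add` only). -/
theorem stripRegular_finset_sum {ι : Type*} (s : Finset ι) {G : ι → (Fin (d + 1) → ℂ) → ℂ} {κ : ℝ} {M : ι → ℝ}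
    (h : ∀ a ∈ s, StripRegular (G a) κ (M a)) : StripRegular (fun p => ∑ a ∈ s, G a p) κ (∑ a ∈ s, M a) := by
  classical
  induction s using Finset.induction_on with
  | empty =>
    have h0 := stripRegular_const (d := d) (0 : ℂ) κ
    simp only [norm_zero] at h0
    simpa using h0
  | insert a s ha ih =>
    have h1 := (h a (Finset.mem_insert_self a s)).add (ih fun b hb => h b (Finset.mem_insert_of_mem hb))
    simpa [Finset.sum_insert ha] using h1

end Restrict

/-! ## §2 The joint momentum space of two momenta and the lift of one-momentum factors

The joint index type of two lattice vectors ∕ momenta of `ℤ^{d+1}` ∕ `ℂ^{d+1}` is written `Fin (d + 1 + d + 1)` (definitionally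
`Fin ((d+1)+(d+1))`, but in the successor shape `Fin (D + 1)`, `D = d + 1 + d`, that the one-momentum interface
`B4ContourShift.{StripRegular, supNorm, latticeKernel_decay}` elaborates against without help). -/

section Joint

variable {d : ℕ} {α : Type*}

/-- [folklore] The index of the `i`-th coordinate of the FIRST momentum in the joint index type. -/
def inl2 (i : Fin (d + 1)) : Fin (d + 1 + d + 1) := @Fin.castAdd (d + 1) (d + 1) i

/-- [folklore] The index of the `i`-th coordinate of the SECOND momentum in the joint index type. -/
def inr2 (i : Fin (d + 1)) : Fin (d + 1 + d + 1) := @Fin.natAdd (d + 1) (d + 1) i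

/-- [folklore] The JOINT vector `(x, y)` of two vectors (`Fin.append` in the successor-shaped index type). -/
def pair (x y : Fin (d + 1) → α) : Fin (d + 1 + d + 1) → α := @Fin.append (d + 1) (d + 1) α x y

/-- [folklore] The joint vector reads `x` on the first indices. -/
@[simp] theorem pair_inl (x y : Fin (d + 1) → α) (i : Fin (d + 1)) : pair x y (inl2 i) = x i :=
  Fin.append_left x y i

/-- [folklore] The joint vector reads `y` on the second indices. -/
@[simp] theorem pair_inr (x y : Fin (d + 1) → α) (i : Fin (d + 1)) : pair x y (inr2 i) = y i :=
  Fin.append_right x y i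

/-- [folklore] `inl2` is injective. -/
theorem inl2_injective : Function.Injective (inl2 (d := d)) := Fin.castAdd_injective _ _

/-- [folklore] `inr2` is injective. -/
theorem inr2_injective : Function.Injective (inr2 (d := d)) := Fin.natAdd_injective _ _

/-- [folklore] A sum over the joint index type splits into the two halves. -/
theorem sum_pair_index {M : Type*} [AddCommMonoid M] (f : Fin (d + 1 + d + 1) → M) :
    ∑ l, f l = ∑ i, f (inl2 i) + ∑ i, f (inr2 i) :=
  @Fin.sum_univ_add M _ (d + 1) (d + 1) f

/-- [folklore] Every joint index is a first-half or a second-half index. -/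
theorem inl2_or_inr2 (l : Fin (d + 1 + d + 1)) : (∃ i, l = inl2 i) ∨ ∃ i, l = inr2 i :=
  @Fin.addCases (d + 1) (d + 1) (fun l => (∃ i, l = inl2 i) ∨ ∃ i, l = inr2 i)
    (fun i => Or.inl ⟨i, rfl⟩) (fun i => Or.inr ⟨i, rfl⟩) l

/-- [folklore] `pair` of differences is the difference of `pair`s. -/
theorem pair_sub {β : Type*} [AddGroup β] (x y x' y' : Fin (d + 1) → β) :
    pair (x - x') (y - y') = pair x y - pair x' y' := by
  funext l
  rcases inl2_or_inr2 l with ⟨i, rfl⟩ | ⟨i, rfl⟩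
  · simp only [Pi.sub_apply, pair_inl]
  · simp only [Pi.sub_apply, pair_inr]

/-- [folklore] `ofRealVec` commutes with `pair`. -/
theorem ofRealVec_pair (p q : Fin (d + 1) → ℝ) : ofRealVec (pair p q) = pair (ofRealVec p) (ofRealVec q) := by
  funext l
  rcases inl2_or_inr2 l with ⟨i, rfl⟩ | ⟨i, rfl⟩
  · show ((pair p q (inl2 i) : ℝ) : ℂ) = pair (ofRealVec p) (ofRealVec q) (inl2 i)
    rw [pair_inl, pair_inl]; rfl
  · show ((pair p q (inr2 i) : ℝ) : ℂ) = pair (ofRealVec p) (ofRealVec q) (inr2 i)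
    rw [pair_inr, pair_inr]; rfl

/-- [folklore] The FIRST momentum `p` of a joint momentum `P = (p, q)`. -/
def fstC (P : Fin (d + 1 + d + 1) → ℂ) : Fin (d + 1) → ℂ := restrict inl2 P

/-- [folklore] The SECOND momentum `q` of a joint momentum `P = (p, q)`. -/
def sndC (P : Fin (d + 1 + d + 1) → ℂ) : Fin (d + 1) → ℂ := restrict inr2 P

/-- [folklore] Unfolding. -/
@[simp] theorem fstC_apply (P : Fin (d + 1 + d + 1) → ℂ) (i : Fin (d + 1)) : fstC P i = P (inl2 i) := rfl

/-- [folklore] Unfolding. -/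
@[simp] theorem sndC_apply (P : Fin (d + 1 + d + 1) → ℂ) (i : Fin (d + 1)) : sndC P i = P (inr2 i) := rfl

/-- [folklore] `fstC` of a joint vector. -/
@[simp] theorem fstC_pair (p q : Fin (d + 1) → ℂ) : fstC (pair p q) = p := by
  funext i; simp

/-- [folklore] `sndC` of a joint vector. -/
@[simp] theorem sndC_pair (p q : Fin (d + 1) → ℂ) : sndC (pair p q) = q := by
  funext i; simp

/-- [folklore] The JOINT SYMBOL of a two-momentum symbol `G(p,q)`: `joint G P = G (fstC P) (sndC P)`. -/
def joint (G : (Fin (d + 1) → ℂ) → (Fin (d + 1) → ℂ) → ℂ) : (Fin (d + 1 + d + 1) → ℂ) → ℂ :=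
  fun P => G (fstC P) (sndC P)

/-- [folklore] Unfolding. -/
@[simp] theorem joint_apply (G : (Fin (d + 1) → ℂ) → (Fin (d + 1) → ℂ) → ℂ) (P : Fin (d + 1 + d + 1) → ℂ) :
    joint G P = G (fstC P) (sndC P) := rfl

/-- [folklore] The joint symbol on a joint vector is the two-momentum symbol. -/
theorem joint_pair (G : (Fin (d + 1) → ℂ) → (Fin (d + 1) → ℂ) → ℂ) (p q : Fin (d + 1) → ℂ) :
    joint G (pair p q) = G p q := by
  simp

/-- [folklore] A ONE-MOMENTUM strip-holomorphic factor `A(p)` is jointly strip holomorphic. -/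
theorem stripHolo_compFst {A : (Fin (d + 1) → ℂ) → ℂ} {κ : ℝ} (h : StripHolo A κ) :
    StripHolo (fun P : Fin (d + 1 + d + 1) → ℂ => A (fstC P)) κ :=
  stripHolo_comp_restrict h inl2_injective

/-- [folklore] A ONE-MOMENTUM strip-holomorphic factor `B(q)` is jointly strip holomorphic. -/
theorem stripHolo_compSnd {B : (Fin (d + 1) → ℂ) → ℂ} {κ : ℝ} (h : StripHolo B κ) :
    StripHolo (fun P : Fin (d + 1 + d + 1) → ℂ => B (sndC P)) κ :=
  stripHolo_comp_restrict h inr2_injective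

/-- [folklore] A ONE-MOMENTUM strip-regular factor `A(p)` is jointly strip regular, same bound. -/
theorem stripRegular_compFst {A : (Fin (d + 1) → ℂ) → ℂ} {κ M : ℝ} (h : StripRegular A κ M) :
    StripRegular (fun P : Fin (d + 1 + d + 1) → ℂ => A (fstC P)) κ M :=
  stripRegular_comp_restrict h inl2_injective

/-- [folklore] A ONE-MOMENTUM strip-regular factor `B(q)` is jointly strip regular, same bound. -/
theorem stripRegular_compSnd {B : (Fin (d + 1) → ℂ) → ℂ} {κ M : ℝ} (h : StripRegular B κ M) :
    StripRegular (fun P : Fin (d + 1 + d + 1) → ℂ => B (sndC P)) κ M :=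
  stripRegular_comp_restrict h inr2_injective

/-- [folklore] PRODUCT SYMBOLS `A(p)·T(p,q)·B(q)`: one-momentum strip-regular outer factors and a jointly strip-regular vertex
give a jointly strip-regular symbol with the product bound. -/
theorem stripRegular_joint_triple {A B : (Fin (d + 1) → ℂ) → ℂ} {T : (Fin (d + 1) → ℂ) → (Fin (d + 1) → ℂ) → ℂ}
    {κ MA MT MB : ℝ} (hA : StripRegular A κ MA) (hT : StripRegular (joint T) κ MT) (hB : StripRegular B κ MB)
    (hMA : 0 ≤ MA) (hMT : 0 ≤ MT) :
    StripRegular (joint fun p q => A p * T p q * B q) κ (MA * MT * MB) :=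
  ((stripRegular_compFst hA).mul hT hMA).mul (stripRegular_compSnd hB) (mul_nonneg hMA hMT)

/-- [folklore] The same in the strip-HOLOMORPHIC class (no bounds). -/
theorem stripHolo_joint_triple {A B : (Fin (d + 1) → ℂ) → ℂ} {T : (Fin (d + 1) → ℂ) → (Fin (d + 1) → ℂ) → ℂ}
    {κ : ℝ} (hA : StripHolo A κ) (hT : StripHolo (joint T) κ) (hB : StripHolo B κ) :
    StripHolo (joint fun p q => A p * T p q * B q) κ :=
  ((stripHolo_compFst hA).mul hT).mul (stripHolo_compSnd hB)

end Joint

end Summit.QuantumFields.BalabanUV.Beta.GAN24.StripRegularRestrict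

end
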